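import Literature.AlgebraicGeometry.Villamayor2007.MultiplicationCharpoly
import Literature.AlgebraicGeometry.Villamayor2007.PurelyRamifiedLocus
import HarnessLib

/-!
# Villamayor 2007, Def. 1.42 (1.42.3) with 1.39 and Def. 1.21, one monic polynomial: the specialized algebra
# `ℋ_f ⊂ S[W]` IS the algebra of weighted coefficients of the characteristic polynomials `ψ_{Δ^e f}` — PROVED

O. E. Villamayor U., *Hypersurface singularities in positive characteristic*, Adv. Math. **213** (2007) 687–733
= arXiv:math/0606796 [Villamayor2007]: 1.7 p0008 L1–L12, 1.18–Def. 1.21 p0010 L1–L53, 1.39–1.40 p0013 L96–L135,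
Def. 1.42 p0014 L16–L64; A. Bravo, O. E. Villamayor U., Adv. Math. **224** (2010) 1349–1418 = arXiv:0807.4308
[BravoVillamayor2010]: Paragraph 2.8 (2.8.1), chunks p0024 L132–p0025 L19. Locators «p00NN Lnn» = chunk · line
of the held arXiv texts (`lit read paper:arxiv-math_0606796`, `lit read paper:arxiv-0807.4308`; p0008, p0010,
p0013, p0014 and BV p0024–p0025 re-read before typing). Campaign `res-hironaka` (D-0089), ladder rung LIT-6
(Villamayor 2007/2008, Bravo–Villamayor as the refereed comparison programme «generic projection + elimination
algebra in place of maximal contact»). PROOF file over the carriers of this folder: theorems only, NO definitions,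
NO named facts; nothing of Hironaka's 2017 manuscript is referred to or asserted.

## What is proved

The folder types Villamayor's computable algebra twice: `CharPolyGenerators.hElimAlgebra k a = ℋ_f` (Def. 1.42
(1.42.3): the `S`-subalgebra of `S[W]` generated by the images `H(a)·W^{deg H}` of ALL homogeneous members `H` of
`H_{F_b}` = Def. 1.21, under the specialization `k[s_{b,1},…,s_{b,b}] → S` attached to `f = monicOf a`) and
`MultiplicationCharpoly.mulCharpolyReesOfFamily f hf ℱ` (Bravo–Villamayor (2.8.1): the `S`-subalgebra generated
by the WEIGHTED COEFFICIENTS `ψ_{g,j}·W^{jn}` of the characteristic polynomials of multiplication by the members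
`g·W^n ∈ ℱ` on `S[Z]/⟨f⟩`). This file proves they coincide for `ℱ = {Δ^e(f)·W^{b−e} ; 1 ≤ e ≤ b − 1}`:

* `specialize_coeff_charPolyOf_univMonicDelta` — **the generators specialize to computable elements** (Def. 1.42
  p0014 L25–L28 «each `f_i(Z)` is obtained from `F_{c_i}(Z)` by the change of base rings `π`» with 1.7 p0008
  L10–L12 «the `Δ^{(α)}` operators are … compatible with change of base rings `R_b → S`» and 1.18/Lemma 1.19): the
  specialization at `a` of the Def. 1.21 generator `coeff_n ψ_{F_b^{(e)}(Y₁)}(V)` of `H_{F_b}` is the coefficient of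
  `T^n` of the characteristic polynomial of multiplication by `Δ^e(f)` on `S[Z]/⟨f⟩`, `f = monicOf a` — proved, as
  the other specialization theorems of this folder (`ChangeOfVariables.specialize_taylor`), at the universal level
  `k[E₁,…,E_b] ↪ k[Y₁,…,Y_b]` (`E_i ↦ s_{b,i}`, injective, carrying `f₀` to `F_b`, where Lemma 1.19
  `mulCharpoly_univMonic` identifies the two characteristic polynomials) and then along `E_i ↦ ±a_i` by
  `mulCharpoly_map`.
* `coeff_mulCharpoly_hasseDeriv_mem_hElimIdeal`, `mulCharpolyRees_hasseDeriv_le_hElimAlgebra`,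
  `mulCharpolyReesOfFamily_hasseDeriv_le_hElimAlgebra` — hence `ψ_{Δ^e f, n}·W^{(b−n)(b−e)} ∈ ℋ_f` (the weight is
  Cor. 1.20's degree `(b − n)(b − e)`, `CharPolyGenerators.isHomogeneous_coeff_charPolyOf_univMonicDelta`), i.e.
  BV2010's coefficient algebra of the family `{Δ^e(f)·W^{b−e}}` lies in `ℋ_f`.
* `homogeneousComponent_mem_span_closure` / `mem_span_closure_of_isHomogeneous` — **1.39** p0013 L104–L108 «If `G`
  is a `k`-algebra generated by elements, say `{H_1,…,H_s}`, where each `H_i` is homogeneous of degree `d_i`; then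
  the graded inclusion of `G` is the `k`-subalgebra in `G[W]` generated, over `k`, by `{H_1W^{d_1},…,H_sW^{d_1}}`»
  (sic, `d_s`), in the form used: a homogeneous member of degree `n` of `k[homogeneous generators] ⊂ k[Y]` is a
  `k`-linear combination of MONOMIALS in the generators which are themselves homogeneous of degree `n`.
* `hElimAlgebra_eq_mulCharpolyReesOfFamily` (and the form `hElimAlgebra_coeffVec_eq_mulCharpolyReesOfFamily` for
  an arbitrary monic `f` of degree `b`) — **Def. 1.42 (1.42.3) made explicit**: `ℋ_f = S[ψ_{Δ^e f, n}·W^{(b−n)(b−e)} ;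
  1 ≤ e ≤ b − 1, n ≤ b]`, i.e. `hElimAlgebra k a = mulCharpolyReesOfFamily (monicOf a) _ {(Δ^e(monicOf a), b − e) ;
  1 ≤ e ≤ b − 1}` — the printed «generated by these coefficients» of BV2010 Par. 2.8 p0025 L11–L19, here for the
  ONE-polynomial algebra `ℋ_f` and as an EQUALITY (no integral closure needed for `ℋ`; the clause «up to integral
  closure» concerns `R̄_f ⊇ ℋ_f`, Prop. 1.23 / (1.42.4), whose integrality half is `IntegralOverH.lean` and whose
  finiteness is NOT proved in the tree).
* `hElimAlgebra_two` — the case `b = 2`: `ℋ_{Z² + a₁Z + a₂} = S[(4a₂ − a₁²)·W²]`, the DISCRIMINANT in weight `2`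
  (Introduction p0004 L93–L102 «generalized discriminants … `D(a_1,…,a_b)` … is the evaluation on the `a_i`'s of a
  universal polynomial … which is weighted homogeneous»; §1 p0006 L22–L23) — a non-vacuity check of the closed form.
* NOT proved / not typed (named so that nobody assumes them): the multi-polynomial algebras `ℋ_{f_{c₁},…,f_{c_r}}`
  (Def. 1.36 / 1.42 for `r ≥ 2`; multi-block specialization, see the TODO in `EliminationAlgebra.lean`); `R̄_f` itself
  in closed form (Prop. 1.23); BV2010 Thm. 1.6. Scope: any commutative ring `k`, any commutative `k`-algebra `S`
  (p0006 L111–L113 «to some extent the form of elimination we discuss here works over arbitrary rings»).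

## References

* O. E. Villamayor U., Adv. Math. 213 (2007) 687–733 = arXiv:math/0606796: 1.7, 1.18–1.21, Cor. 1.20, 1.39–1.40,
  Def. 1.42. [Villamayor2007]
* A. Bravo, O. E. Villamayor U., Adv. Math. 224 (2010) 1349–1418 = arXiv:0807.4308: Paragraph 2.8 (2.8.1).
  [BravoVillamayor2010]
-/

noncomputable section

open scoped Polynomial

namespace Literature.AlgebraicGeometry.Villamayor2007

open MvPolynomial

universe u v w

/-! ## Def. 1.42 / 1.7: the generators of `H_{F_b}` specialize to the coefficients of `ψ_{Δ^e f}` -/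

section Specialize

variable (k : Type v) [CommRing k] {S : Type w} [CommRing S] [Algebra k S] {b : ℕ}

/-- **Specialization of the Def. 1.21 generators** [Villamayor 2007, Def. 1.42 p0014 L16–L28 «Fix a `k`-algebra
`S` and monic polynomials `f_i(Z)` … each `f_i(Z)` is obtained from `F_{c_i}(Z)` by the change of base rings
`π : k[s^{(i)}_1,…,s^{(i)}_{c_i}] → S` defined by setting `π(s^{(i)}_j) = a^{(i)}_j`», 1.7 p0008 L10–L12 «the `Δ^{(α)}`
operators are, in a natural sense, compatible with change of base rings `R_b → S`», 1.18 / Lemma 1.19 p0010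
L1–L28]: for `f = monicOf a ∈ S[Z]` and every `e, n`, the specialization `R_b → S` attached to `a` sends the
coefficient of `V^n` of `ψ_{F_b^{(e)}(Y_1)}(V)` (a generator of `H_{F_b}`, Def. 1.21 p0010 L50–L53, typed by the product
formula `CharPolyGenerators.charPolyOf`) to the coefficient of `T^n` of the characteristic polynomial of
MULTIPLICATION BY `Δ^e(f)` on `S[Z]/⟨f⟩` (`MultiplicationCharpoly.mulCharpoly`). Proof at the universal level
`k[E] ↪ k[Y]`, `E_i ↦ s_{b,i}` (injective, `f₀ ↦ F_b`; there Lemma 1.19 `mulCharpoly_univMonic` identifies the two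
polynomials), then along `E_i ↦ (−1)^{i+1}a_i` by `mulCharpoly_map` and `hasseDeriv_map`. The membership proof `h` is
arbitrary (it holds by `isSymmetric_coeff_charPolyOf_univMonicDelta`). [cite: Villamayor2007, Def. 1.42 p0014 L16–L28] -/
theorem specialize_coeff_charPolyOf_univMonicDelta (a : Fin b → S) (e n : ℕ)
    (h : (charPolyOf (Fin b) k (univMonicDelta (Fin b) k e)).coeff n ∈ symmetricSubalgebra (Fin b) k) :
    specialize k a ⟨(charPolyOf (Fin b) k (univMonicDelta (Fin b) k e)).coeff n, h⟩ =
      (mulCharpoly (monicOf a) (monicOf_monic a) (Polynomial.hasseDeriv e (monicOf a))).coeff n := by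
  rcases subsingleton_or_nontrivial k with hk | hk
  · have : Subsingleton S := by
      refine subsingleton_of_zero_eq_one ?_
      rw [← (algebraMap k S).map_one, Subsingleton.elim (1 : k) 0, map_zero]
    exact Subsingleton.elim _ _
  let G' : symmetricSubalgebra (Fin b) k := ⟨(charPolyOf (Fin b) k (univMonicDelta (Fin b) k e)).coeff n, h⟩
  let a₀ : Fin b → MvPolynomial (Fin b) k := fun i => (-1 : MvPolynomial (Fin b) k) ^ ((i : ℕ) + 1) * X i
  -- the universal identity, over `k[E₁,…,E_b]` with `f₀ = Z^b − E₁Z^{b−1} + E₂Z^{b−2} − …`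
  have huniv : specialize k a₀ G' =
      (mulCharpoly (monicOf a₀) (monicOf_monic a₀) (Polynomial.hasseDeriv e (monicOf a₀))).coeff n := by
    let Φ : MvPolynomial (Fin b) k →ₐ[k] MvPolynomial (Fin b) k :=
      aeval (fun i : Fin b => esymm (Fin b) k ((i : ℕ) + 1))
    have hΦa₀ : ⇑Φ ∘ a₀ = coeffVec b (univMonic (Fin b) k) := aeval_esymm_comp_univCoeff
    have hf : (monicOf a₀).map (Φ : MvPolynomial (Fin b) k →+* MvPolynomial (Fin b) k) = univMonic (Fin b) k := by
      rw [monicOf_map Φ, hΦa₀]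
      exact monicOf_coeffVec univMonic_monic (by rw [natDegree_univMonic, Fintype.card_fin])
    apply aeval_esymm_injective
    change Φ (specialize k a₀ G') = Φ _
    rw [← AlgHom.comp_apply, ← specialize_comp, hΦa₀, specialize_coeffVec_univMonic]
    have hL : aeval (fun i : Fin b => (X i : MvPolynomial (Fin b) k)) (G' : MvPolynomial (Fin b) k) =
        (G' : MvPolynomial (Fin b) k) := aeval_X_left_apply _
    rw [hL]
    have hR : Φ ((mulCharpoly (monicOf a₀) (monicOf_monic a₀) (Polynomial.hasseDeriv e (monicOf a₀))).coeff n) =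
        ((mulCharpoly (monicOf a₀) (monicOf_monic a₀) (Polynomial.hasseDeriv e (monicOf a₀))).map
          (Φ : MvPolynomial (Fin b) k →+* MvPolynomial (Fin b) k)).coeff n := by
      rw [Polynomial.coeff_map]; rfl
    rw [hR, mulCharpoly_map, hasseDeriv_map, mulCharpoly_eq_of_eq hf _ univMonic_monic, hf,
      mulCharpoly_univMonic]
    rfl
  -- specialize the universal identity along `E_i ↦ (−1)^{i+1} a_i`
  let ψ : MvPolynomial (Fin b) k →ₐ[k] S := aeval fun i : Fin b => (-1 : S) ^ ((i : ℕ) + 1) * a i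
  have hψa₀ : ⇑ψ ∘ a₀ = a := by
    funext i
    rw [Function.comp_apply, map_mul, map_pow, map_neg, map_one, aeval_X, ← mul_assoc, ← pow_add,
      ← two_mul, pow_mul, neg_one_sq, one_pow, one_mul]
  have hf : (monicOf a₀).map (ψ : MvPolynomial (Fin b) k →+* S) = monicOf a := by
    rw [monicOf_map ψ, hψa₀]
  have h1 := congrArg ψ huniv
  change ψ (specialize k a₀ G') = ψ _ at h1
  rw [← AlgHom.comp_apply, ← specialize_comp, hψa₀] at h1
  rw [h1]
  have hR : ψ ((mulCharpoly (monicOf a₀) (monicOf_monic a₀) (Polynomial.hasseDeriv e (monicOf a₀))).coeff n) =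
      ((mulCharpoly (monicOf a₀) (monicOf_monic a₀) (Polynomial.hasseDeriv e (monicOf a₀))).map
        (ψ : MvPolynomial (Fin b) k →+* S)).coeff n := by
    rw [Polynomial.coeff_map]; rfl
  rw [hR, mulCharpoly_map, hasseDeriv_map, mulCharpoly_eq_of_eq hf _ (monicOf_monic a), hf]

end Specialize

section Generators

variable (k : Type v) [CommRing k] {S : Type w} [CommRing S] [Algebra k S] {b : ℕ}

/-! ## (1.42.3): the weighted coefficients `ψ_{Δ^e f, n}·W^{(b−n)(b−e)}` lie in `ℋ_f` -/

/-- **The computable elements of `ℋ_f`** [Villamayor 2007, Def. 1.42 (1.42.3) p0014 L47–L54 «`ℋ_{f}` … the subalgebra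
of `S[W]` generated by the image of `U^{(2)} = Σ I^{(2)}_k W^k`», 1.40 p0013 L120–L124 «generated over `T` by all
elements of the form `H(s)·W^{d_H}` where `H` is an homogeneous element of degree `d_H` … in `H_{F_b}`», with the degree
of Cor. 1.20 p0010 L35–L41]: for `1 ≤ e ≤ b − 1` and `n ≤ b`, the coefficient of `T^n` of `ψ_{Δ^e f}` (`f = monicOf a`)
lies in the ideal `I^{(2)}_{(b−n)(b−e)}` of `ℋ_f = ⊕ I^{(2)}_r W^r` — it is the image of the homogeneous generator
`coeff_n ψ_{F_b^{(e)}(Y_1)}` of degree `(b − n)(b − e)`. [cite: Villamayor2007, Def. 1.42 (1.42.3) p0014 L47–L54] -/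
theorem coeff_mulCharpoly_hasseDeriv_mem_hElimIdeal (a : Fin b → S) {e : ℕ} (he1 : 1 ≤ e) (he : e + 1 ≤ b)
    {n : ℕ} (hn : n ≤ b) :
    (mulCharpoly (monicOf a) (monicOf_monic a) (Polynomial.hasseDeriv e (monicOf a))).coeff n ∈
      hElimIdeal k a ((b - n) * (b - e)) := by
  have hmem : (charPolyOf (Fin b) k (univMonicDelta (Fin b) k e)).coeff n ∈ hSubalgebra (Fin b) k :=
    coeff_charPolyOf_mem_hSubalgebra he1 (by rw [Fintype.card_fin]; exact he) n
  have hhom : ((charPolyOf (Fin b) k (univMonicDelta (Fin b) k e)).coeff n).IsHomogeneous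
      ((b - n) * (b - e)) := by
    have h := isHomogeneous_coeff_charPolyOf_univMonicDelta (k := k) (ι := Fin b) (e := e) (n := n)
      (by rw [Fintype.card_fin]; omega) (by rw [Fintype.card_fin]; exact hn)
    rwa [Fintype.card_fin] at h
  rw [← specialize_coeff_charPolyOf_univMonicDelta k a e n (hSubalgebra_le_symmetricSubalgebra hmem)]
  exact Ideal.subset_span ⟨_, hmem, hhom, rfl⟩

/-- The same in `S[W]`: `ψ_{Δ^e f, n}·W^{(b−n)(b−e)} ∈ ℋ_f` (`1 ≤ e ≤ b − 1`, `n ≤ b`).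
[cite: Villamayor2007, Def. 1.42 (1.42.3) p0014 L47–L54] -/
theorem monomial_coeff_mulCharpoly_hasseDeriv_mem_hElimAlgebra (a : Fin b → S) {e : ℕ} (he1 : 1 ≤ e)
    (he : e + 1 ≤ b) {n : ℕ} (hn : n ≤ b) :
    Polynomial.monomial ((b - n) * (b - e))
        ((mulCharpoly (monicOf a) (monicOf_monic a) (Polynomial.hasseDeriv e (monicOf a))).coeff n) ∈
      hElimAlgebra k a :=
  monomial_mem_reesOfFamily (coeff_mulCharpoly_hasseDeriv_mem_hElimIdeal k a he1 he hn)

/-- **BV2010 (2.8.1) inside `ℋ_f`** [Bravo–Villamayor 2010, Par. 2.8 p0025 L1–L19 «each endomorphism `L_{f_{n_i}}` has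
a characteristic polynomial of degree `n`, `T^n + g_{1,n_i}T^{n−1} + … + g_{n,n_i}` (2.8.1) where `g_{j,n_i} ∈ 𝒪[W]` and
the elimination algebra … is generated by these coefficients up to integral closure»]: for the member
`Δ^e(f)·W^{b−e}` (`1 ≤ e ≤ b − 1`) the whole weighted coefficient algebra `S[ψ_{Δ^e f, b−j}·W^{j(b−e)} ; 1 ≤ j ≤ b]`
(`mulCharpolyRees`) is contained in `ℋ_f`. [cite: BravoVillamayor2010, Par. 2.8 (2.8.1)] -/
theorem mulCharpolyRees_hasseDeriv_le_hElimAlgebra (a : Fin b → S) {e : ℕ} (he1 : 1 ≤ e) (he : e + 1 ≤ b) :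
    mulCharpolyRees (monicOf a) (monicOf_monic a) (Polynomial.hasseDeriv e (monicOf a)) (b - e) ≤
      hElimAlgebra k a := by
  rcases subsingleton_or_nontrivial S with hS | hS
  · intro q _
    rw [Subsingleton.elim q 0]
    exact zero_mem _
  refine Algebra.adjoin_le ?_
  rintro _ ⟨j, hj1, hj, rfl⟩
  rw [natDegree_monicOf] at hj ⊢
  have h := monomial_coeff_mulCharpoly_hasseDeriv_mem_hElimAlgebra k a he1 he (n := b - j) (by omega)
  rwa [show b - (b - j) = j by omega] at h

/-- The family form: the coefficient algebra of `ℱ = {Δ^e(f)·W^{b−e} ; 1 ≤ e ≤ b − 1}` (`mulCharpolyReesOfFamily`) is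
contained in `ℋ_f` — one half of `hElimAlgebra_eq_mulCharpolyReesOfFamily`. [cite: BravoVillamayor2010, Par. 2.8 (2.8.1)] -/
theorem mulCharpolyReesOfFamily_hasseDeriv_le_hElimAlgebra (a : Fin b → S) :
    mulCharpolyReesOfFamily (monicOf a) (monicOf_monic a)
        {gn | ∃ e : ℕ, 1 ≤ e ∧ e + 1 ≤ b ∧ gn = (Polynomial.hasseDeriv e (monicOf a), b - e)} ≤
      hElimAlgebra k a := by
  unfold mulCharpolyReesOfFamily
  refine iSup₂_le fun gn hgn => ?_
  obtain ⟨e, he1, he, rfl⟩ := hgn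
  exact mulCharpolyRees_hasseDeriv_le_hElimAlgebra k a he1 he

end Generators

section GradedSpan

variable {ι : Type u} {k : Type v} [CommRing k]

/-! ## 1.39: homogeneous members of an algebra generated by homogeneous elements -/

/-- **1.39, graded span form** [Villamayor 2007, 1.39 p0013 L104–L108 «If `G` is a `k`-algebra generated by elements, say
`{H_1,…,H_s}`, where each `H_i` is homogeneous of degree `d_i`; then the graded inclusion of `G` is the `k`-subalgebra
in `G[W]` generated, over `k`, by `{H_1W^{d_1},…,H_sW^{d_1}}`» (sic; `d_s`)]: for a set `s ⊂ k[Y]` of homogeneous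
elements and `p ∈ k[s]`, the degree-`n` component of `p` is a `k`-linear combination of monomials in `s` (members of
the multiplicative closure of `s`) that are homogeneous of degree `n` — so `[G]_n W^n` is spanned by products of the
`H_iW^{d_i}`. (Cf. `UniversalElimination.homogeneousComponent_mem_adjoin_of_homogeneous`, the weaker closure
statement.) [cite: Villamayor2007, 1.39 p0013 L96–L108] -/
theorem homogeneousComponent_mem_span_closure {s : Set (MvPolynomial ι k)}
    (hs : ∀ x ∈ s, ∃ d, x.IsHomogeneous d) {p : MvPolynomial ι k} (hp : p ∈ Algebra.adjoin k s) (n : ℕ) :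
    homogeneousComponent n p ∈
      Submodule.span k {m | m ∈ Submonoid.closure s ∧ m.IsHomogeneous n} := by
  have hmon : ∀ x ∈ Submonoid.closure s, ∃ d, x.IsHomogeneous d := by
    intro x hx
    induction hx using Submonoid.closure_induction with
    | mem x hx => exact hs x hx
    | one => exact ⟨0, isHomogeneous_one ι k⟩
    | mul x y _ _ hx hy =>
      obtain ⟨d, hd⟩ := hx
      obtain ⟨e, he⟩ := hy
      exact ⟨d + e, hd.mul he⟩
  have hspan : p ∈ Submodule.span k (Submonoid.closure s : Set (MvPolynomial ι k)) := by
    rw [← Algebra.adjoin_eq_span]; exact hp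
  clear hp
  revert n
  induction hspan using Submodule.span_induction with
  | mem x hx =>
    intro n
    obtain ⟨d, hd⟩ := hmon x hx
    rw [homogeneousComponent_of_mem hd]
    split_ifs with h
    · subst h
      exact Submodule.subset_span ⟨hx, hd⟩
    · exact zero_mem _
  | zero => intro n; simp
  | add x y _ _ hx hy => intro n; rw [map_add]; exact add_mem (hx n) (hy n)
  | smul c x _ hx => intro n; rw [map_smul]; exact Submodule.smul_mem _ c (hx n)

/-- 1.39 for a homogeneous member: `p ∈ k[s]` homogeneous of degree `n` is a `k`-combination of degree-`n` monomials
in `s`. [cite: Villamayor2007, 1.39 p0013 L96–L108] -/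
theorem mem_span_closure_of_isHomogeneous {s : Set (MvPolynomial ι k)}
    (hs : ∀ x ∈ s, ∃ d, x.IsHomogeneous d) {p : MvPolynomial ι k} (hp : p ∈ Algebra.adjoin k s) {n : ℕ}
    (hpn : p.IsHomogeneous n) :
    p ∈ Submodule.span k {m | m ∈ Submonoid.closure s ∧ m.IsHomogeneous n} := by
  have h := homogeneousComponent_mem_span_closure hs hp n
  rwa [homogeneousComponent_of_mem hpn, if_pos rfl] at h

end GradedSpan

section Identification

variable (k : Type v) [CommRing k] {S : Type w} [CommRing S] [Algebra k S] {b : ℕ}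

/-! ## Def. 1.42 (1.42.3) made explicit: `ℋ_f` is the coefficient algebra of `{Δ^e(f)·W^{b−e}}` -/

/-- Bookkeeping for the generators of (2.8.1): for `f = monicOf a` over a nontrivial `S` (so `deg f = b`) and `n ≤ b`,
`ψ_{Δ^e f, n}·W^{(b−n)(b−e)}` is a generator of `mulCharpolyRees f (Δ^e f) (b − e)` when `n < b`, and is `1` when
`n = b` (the characteristic polynomial is monic of degree `b`). [cite: BravoVillamayor2010, Par. 2.8 (2.8.1)] -/
theorem monomial_coeff_mulCharpoly_hasseDeriv_mem_mulCharpolyRees [Nontrivial S] (a : Fin b → S) (e : ℕ)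
    {n : ℕ} (hn : n ≤ b) :
    Polynomial.monomial ((b - n) * (b - e))
        ((mulCharpoly (monicOf a) (monicOf_monic a) (Polynomial.hasseDeriv e (monicOf a))).coeff n) ∈
      mulCharpolyRees (monicOf a) (monicOf_monic a) (Polynomial.hasseDeriv e (monicOf a)) (b - e) := by
  rcases hn.eq_or_lt with rfl | hlt
  · have h1 : (mulCharpoly (monicOf a) (monicOf_monic a) (Polynomial.hasseDeriv e (monicOf a))).coeff n = 1 := by
      have h := (mulCharpoly_monic (monicOf a) (monicOf_monic a)
        (Polynomial.hasseDeriv e (monicOf a))).coeff_natDegree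
      rwa [natDegree_mulCharpoly, natDegree_monicOf] at h
    rw [h1, Nat.sub_self, zero_mul, Polynomial.monomial_zero_left, map_one]
    exact one_mem _
  · have h := monomial_coeff_mem_mulCharpolyRees (monicOf a) (monicOf_monic a)
      (Polynomial.hasseDeriv e (monicOf a)) (b - e) (j := b - n) (by omega) (by rw [natDegree_monicOf]; omega)
    rwa [natDegree_monicOf, show b - (b - n) = n by omega] at h

/-- Monomials in the Def. 1.21 generators are symmetric (`H_{F_b} ⊆ R_b`, Lemma 1.22 p0010 L55–L56), so the
specialization `R_b → S` is defined on them. [cite: Villamayor2007, Lemma 1.22 p0010 L55–L56] -/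
theorem hGenSet_subset_symmetricSubalgebra :
    Submonoid.closure (hGenSet (Fin b) k) ≤ (symmetricSubalgebra (Fin b) k).toSubmonoid :=
  Submonoid.closure_le.mpr fun _ hx =>
    hSubalgebra_le_symmetricSubalgebra (Algebra.subset_adjoin hx)

/-- **Monomials in the generators** (the multiplicative half of 1.39 / 1.40 p0013 L120–L124 «generated over `T` by
all elements of the form `H·W^{d_H}`»): every monomial `m` in the Def. 1.21 generators of `H_{F_b}` is homogeneous of
some degree `d` with `m(a)·W^d` in the coefficient algebra of `{Δ^e(f)·W^{b−e}}` — generators by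
`specialize_coeff_charPolyOf_univMonicDelta`, products by `W^{d₁}·W^{d₂} = W^{d₁+d₂}`.
[cite: Villamayor2007, 1.40 p0013 L114–L124] -/
theorem exists_monomial_specialize_mem_of_mem_closure [Nontrivial S] (a : Fin b → S)
    {m : MvPolynomial (Fin b) k} (hm : m ∈ Submonoid.closure (hGenSet (Fin b) k)) :
    ∃ d : ℕ, m.IsHomogeneous d ∧
      Polynomial.monomial d (specialize k a ⟨m, hGenSet_subset_symmetricSubalgebra k hm⟩) ∈
        mulCharpolyReesOfFamily (monicOf a) (monicOf_monic a)
          {gn | ∃ e : ℕ, 1 ≤ e ∧ e + 1 ≤ b ∧ gn = (Polynomial.hasseDeriv e (monicOf a), b - e)} := by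
  induction hm using Submonoid.closure_induction with
  | mem x hx =>
    obtain ⟨e, n, he1, he, rfl⟩ := hx
    rw [Fintype.card_fin] at he
    by_cases hn : n ≤ b
    · refine ⟨(b - n) * (b - e), ?_, ?_⟩
      · have h := isHomogeneous_coeff_charPolyOf_univMonicDelta (k := k) (ι := Fin b) (e := e) (n := n)
          (by rw [Fintype.card_fin]; omega) (by rw [Fintype.card_fin]; exact hn)
        rwa [Fintype.card_fin] at h
      · rw [specialize_coeff_charPolyOf_univMonicDelta]
        have hF : (Polynomial.hasseDeriv e (monicOf a), b - e) ∈
            {gn | ∃ e : ℕ, 1 ≤ e ∧ e + 1 ≤ b ∧ gn = (Polynomial.hasseDeriv e (monicOf a), b - e)} :=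
          ⟨e, he1, he, rfl⟩
        exact mulCharpolyRees_le_ofFamily (monicOf a) (monicOf_monic a) hF
          (monomial_coeff_mulCharpoly_hasseDeriv_mem_mulCharpolyRees a e hn)
    · have h0 : (charPolyOf (Fin b) k (univMonicDelta (Fin b) k e)).coeff n = 0 :=
        Polynomial.coeff_eq_zero_of_natDegree_lt
          ((natDegree_charPolyOf_le _).trans_lt (by rw [Fintype.card_fin]; omega))
      refine ⟨0, ?_, ?_⟩
      · rw [h0]; exact isHomogeneous_zero _ _ 0
      · have : (⟨(charPolyOf (Fin b) k (univMonicDelta (Fin b) k e)).coeff n,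
            hGenSet_subset_symmetricSubalgebra k (Submonoid.subset_closure ⟨e, n, he1,
              (by rw [Fintype.card_fin]; exact he), rfl⟩)⟩ : symmetricSubalgebra (Fin b) k) = 0 := by
          exact Subtype.ext h0
        rw [this, map_zero, map_zero]
        exact zero_mem _
  | one =>
    refine ⟨0, isHomogeneous_one _ _, ?_⟩
    have : (⟨(1 : MvPolynomial (Fin b) k), hGenSet_subset_symmetricSubalgebra k (one_mem _)⟩ :
        symmetricSubalgebra (Fin b) k) = 1 := rfl
    rw [this, map_one, Polynomial.monomial_zero_left, map_one]
    exact one_mem _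
  | mul x y hx hy ihx ihy =>
    obtain ⟨d₁, hd₁, h₁⟩ := ihx
    obtain ⟨d₂, hd₂, h₂⟩ := ihy
    refine ⟨d₁ + d₂, hd₁.mul hd₂, ?_⟩
    have : (⟨x * y, hGenSet_subset_symmetricSubalgebra k (mul_mem hx hy)⟩ : symmetricSubalgebra (Fin b) k) =
        ⟨x, hGenSet_subset_symmetricSubalgebra k hx⟩ * ⟨y, hGenSet_subset_symmetricSubalgebra k hy⟩ := rfl
    rw [this, map_mul, ← Polynomial.monomial_mul_monomial]
    exact mul_mem h₁ h₂

/-- The `k`-span of the degree-`r` monomials in the generators lies in `R_b` (so `specialize` is defined on it).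
[cite: Villamayor2007, Lemma 1.22 p0010 L55–L56] -/
theorem span_closure_hGenSet_le_symmetricSubalgebra (r : ℕ) :
    Submodule.span k {m | m ∈ Submonoid.closure (hGenSet (Fin b) k) ∧ m.IsHomogeneous r} ≤
      Subalgebra.toSubmodule (symmetricSubalgebra (Fin b) k) :=
  Submodule.span_le.mpr fun _ hm => hGenSet_subset_symmetricSubalgebra k hm.1

/-- The `k`-linear half of 1.39: for `x` in the `k`-span of the degree-`r` monomials in the generators, `x(a)·W^r`
lies in the coefficient algebra of `{Δ^e(f)·W^{b−e}}` (a `k`-multiple `c·q` of a member `q` of an `S`-subalgebra of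
`S[W]` is the `S`-multiple `(c·1_S)·q`). [cite: Villamayor2007, 1.39 p0013 L96–L108] -/
theorem monomial_specialize_mem_of_mem_span [Nontrivial S] (a : Fin b → S) {r : ℕ}
    {x : MvPolynomial (Fin b) k}
    (hx : x ∈ Submodule.span k {m | m ∈ Submonoid.closure (hGenSet (Fin b) k) ∧ m.IsHomogeneous r}) :
    Polynomial.monomial r (specialize k a ⟨x, span_closure_hGenSet_le_symmetricSubalgebra k r hx⟩) ∈
      mulCharpolyReesOfFamily (monicOf a) (monicOf_monic a)
        {gn | ∃ e : ℕ, 1 ≤ e ∧ e + 1 ≤ b ∧ gn = (Polynomial.hasseDeriv e (monicOf a), b - e)} := by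
  induction hx using Submodule.span_induction with
  | mem x hx =>
    obtain ⟨d, hd, hA⟩ := exists_monomial_specialize_mem_of_mem_closure k a hx.1
    by_cases hx0 : x = 0
    · subst hx0
      have : (⟨(0 : MvPolynomial (Fin b) k), span_closure_hGenSet_le_symmetricSubalgebra k r
          (Submodule.subset_span hx)⟩ : symmetricSubalgebra (Fin b) k) = 0 := rfl
      rw [this, map_zero, map_zero]
      exact zero_mem _
    · have hrd : r = d := hx.2.inj_right hd hx0
      subst hrd
      exact hA
  | zero =>
    have : (⟨(0 : MvPolynomial (Fin b) k), span_closure_hGenSet_le_symmetricSubalgebra k r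
        (zero_mem _)⟩ : symmetricSubalgebra (Fin b) k) = 0 := rfl
    rw [this, map_zero, map_zero]
    exact zero_mem _
  | add x y hx hy ihx ihy =>
    have : (⟨x + y, span_closure_hGenSet_le_symmetricSubalgebra k r (add_mem hx hy)⟩ :
        symmetricSubalgebra (Fin b) k) =
        ⟨x, span_closure_hGenSet_le_symmetricSubalgebra k r hx⟩ +
          ⟨y, span_closure_hGenSet_le_symmetricSubalgebra k r hy⟩ := rfl
    rw [this, map_add, map_add]
    exact add_mem ihx ihy
  | smul c x hx ihx =>
    have : (⟨c • x, span_closure_hGenSet_le_symmetricSubalgebra k r (Submodule.smul_mem _ c hx)⟩ :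
        symmetricSubalgebra (Fin b) k) =
        c • ⟨x, span_closure_hGenSet_le_symmetricSubalgebra k r hx⟩ := rfl
    rw [this, map_smul, ← Polynomial.smul_monomial, ← algebraMap_smul S c]
    exact Subalgebra.smul_mem _ ihx _

/-- **Every generator `H(a)·W^{d_H}` of `ℋ_f` is a polynomial in the weighted coefficients** [Villamayor 2007, 1.40
p0013 L120–L124 with 1.39 and Def. 1.21]: for `H ∈ H_{F_b}` homogeneous of degree `r`, `H(a)·W^r ∈
S[ψ_{Δ^e f, n}·W^{(b−n)(b−e)}]`. [cite: Villamayor2007, Def. 1.42 (1.42.3) p0014 L47–L54] -/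
theorem monomial_specialize_mem_mulCharpolyReesOfFamily [Nontrivial S] (a : Fin b → S)
    {H : MvPolynomial (Fin b) k} (hH : H ∈ hSubalgebra (Fin b) k) {r : ℕ} (hhom : H.IsHomogeneous r)
    (hsym : H ∈ symmetricSubalgebra (Fin b) k) :
    Polynomial.monomial r (specialize k a ⟨H, hsym⟩) ∈
      mulCharpolyReesOfFamily (monicOf a) (monicOf_monic a)
        {gn | ∃ e : ℕ, 1 ≤ e ∧ e + 1 ≤ b ∧ gn = (Polynomial.hasseDeriv e (monicOf a), b - e)} := by
  have hgen : ∀ x ∈ hGenSet (Fin b) k, ∃ d, x.IsHomogeneous d := by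
    rintro _ ⟨e, n, -, he, rfl⟩
    by_cases hn : n ≤ Fintype.card (Fin b)
    · exact ⟨_, isHomogeneous_coeff_charPolyOf_univMonicDelta (by omega) hn⟩
    · refine ⟨0, ?_⟩
      rw [Polynomial.coeff_eq_zero_of_natDegree_lt ((natDegree_charPolyOf_le _).trans_lt (by omega))]
      exact isHomogeneous_zero _ _ 0
  exact monomial_specialize_mem_of_mem_span k a (mem_span_closure_of_isHomogeneous hgen hH hhom)

/-- **Def. 1.42 (1.42.3), one monic polynomial, in closed form** [Villamayor 2007, Def. 1.42 p0014 L47–L54 «`ℋ_{f}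
(⊂ S[W])` as the subalgebra of `S[W]` generated by the image of `U^{(2)} = Σ I^{(2)}_k W^k`», with Def. 1.21 p0010
L50–L53 («`H_{F_b}` … generated by the coefficients of the `b − 1` characteristic polynomials `ψ_{F_b^{(e)}(Y_1)}(V)`,
for `1 ≤ e ≤ b − 1`»), 1.39–1.40 and Bravo–Villamayor 2010 Par. 2.8 (2.8.1) p0025 L11–L19 («generated by these
coefficients»)]: for `f = monicOf a ∈ S[Z]`,
`ℋ_f = S[ψ_{Δ^e f, n}·W^{(b−n)(b−e)} ; 1 ≤ e ≤ b − 1, n ≤ b]`, i.e. `CharPolyGenerators.hElimAlgebra k a` IS the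
weighted coefficient algebra `mulCharpolyReesOfFamily f {(Δ^e(f), b − e) ; 1 ≤ e ≤ b − 1}` of the characteristic
polynomials of multiplication by the Hasse derivatives `Δ^e(f)` on `S[Z]/⟨f⟩` — an equality (for the bigger
elimination algebra `R̄_f ⊇ ℋ_f` only «up to integral closure», Prop. 1.23 / (1.42.4), not proved here). Any
commutative `k`, any commutative `k`-algebra `S`. [cite: Villamayor2007, Def. 1.42 (1.42.3) p0014 L47–L54] -/
theorem hElimAlgebra_eq_mulCharpolyReesOfFamily (a : Fin b → S) :
    hElimAlgebra k a = mulCharpolyReesOfFamily (monicOf a) (monicOf_monic a)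
      {gn | ∃ e : ℕ, 1 ≤ e ∧ e + 1 ≤ b ∧ gn = (Polynomial.hasseDeriv e (monicOf a), b - e)} := by
  refine le_antisymm ?_ (mulCharpolyReesOfFamily_hasseDeriv_le_hElimAlgebra k a)
  rcases subsingleton_or_nontrivial S with hS | hS
  · intro q _
    rw [Subsingleton.elim q 0]
    exact zero_mem _
  unfold hElimAlgebra reesOfFamily
  refine Algebra.adjoin_le ?_
  rintro _ ⟨r, c, hc, rfl⟩
  unfold hElimIdeal at hc
  induction hc using Submodule.span_induction with
  | mem x hx =>
    obtain ⟨H, hH, hhom, rfl⟩ := hx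
    exact monomial_specialize_mem_mulCharpolyReesOfFamily k a hH hhom _
  | zero => rw [map_zero]; exact zero_mem _
  | add x y _ _ hx hy => rw [map_add]; exact add_mem hx hy
  | smul s x _ hx =>
    rw [← Polynomial.smul_monomial]
    exact Subalgebra.smul_mem _ hx s

/-- The same for an arbitrary monic `f ∈ S[Z]` of degree `b` (through its coefficient vector, `monicOf (coeffVec b f) =
f`): `ℋ_f = S[ψ_{Δ^e f, n}·W^{(b−n)(b−e)} ; 1 ≤ e ≤ b − 1, n ≤ b]`. [cite: Villamayor2007, Def. 1.42 (1.42.3) p0014 L47–L54] -/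
theorem hElimAlgebra_coeffVec_eq_mulCharpolyReesOfFamily {f : S[X]} (hf : f.Monic) (hdeg : f.natDegree = b) :
    hElimAlgebra k (coeffVec b f) = mulCharpolyReesOfFamily f hf
      {gn | ∃ e : ℕ, 1 ≤ e ∧ e + 1 ≤ b ∧ gn = (Polynomial.hasseDeriv e f, b - e)} := by
  have h := hElimAlgebra_eq_mulCharpolyReesOfFamily k (coeffVec b f)
  simp only [monicOf_coeffVec hf hdeg] at h
  exact h

end Identification

/-! ## `b = 2`: the first generalized discriminant is the discriminant -/

section Quadratic

variable (k : Type v) [CommRing k] {S : Type w} [CommRing S] [Algebra k S]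

/-- `monicOf` in degree two: `f = Z² + a₁Z + a₂` (p0007 L15 «`f(Z) = Z^b + a_1Z^{b−1} + … + a_b`»).
[cite: Villamayor2007, §1.5 p0007 L15] -/
theorem monicOf_two (a : Fin 2 → S) :
    monicOf a = Polynomial.X ^ 2 + Polynomial.C (a 0) * Polynomial.X + Polynomial.C (a 1) := by
  simp [monicOf, Fin.sum_univ_two, add_assoc]

/-- `Δ^1(Z² + a₁Z + a₂) = a₁ + 2Z` (Def. 1.2: `Δ^1` is the derivative). [cite: Villamayor2007, Def. 1.2 p0006 L54–L65] -/
theorem hasseDeriv_one_monicOf_two (a : Fin 2 → S) :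
    Polynomial.hasseDeriv 1 (monicOf a) = Polynomial.C (a 0) + Polynomial.C 2 * Polynomial.X := by
  rw [Polynomial.hasseDeriv_one, monicOf_two]
  simp only [map_add, Polynomial.derivative_X_pow, Polynomial.derivative_mul, Polynomial.derivative_C,
    zero_mul, Polynomial.derivative_X, mul_one, zero_add, add_zero]
  simp only [Nat.cast_ofNat, Nat.add_one_sub_one, pow_one]
  ring

/-- For `f = Z² + a₁Z + a₂` the characteristic polynomial of multiplication by `Δ^1(f) = 2Z + a₁` on `S[Z]/⟨f⟩` is
`T² − (a₁² − 4a₂)`: the only nonzero weighted coefficient is (minus) the DISCRIMINANT (p0004 L91 «Among these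
equations is the discriminant of `f(Z)`»; by `mulCharpoly_quadratic`). [cite: Villamayor2007, Introduction p0004 L86–L102] -/
theorem mulCharpoly_hasseDeriv_one_monicOf_two (a : Fin 2 → S) :
    mulCharpoly (monicOf a) (monicOf_monic a) (Polynomial.hasseDeriv 1 (monicOf a)) =
      Polynomial.X ^ 2 + Polynomial.C (4 * a 1 - a 0 ^ 2) := by
  rw [hasseDeriv_one_monicOf_two, mulCharpoly_eq_of_eq (monicOf_two a) _ (monic_quadratic (a 0) (a 1)),
    mulCharpoly_quadratic]
  have h1 : (2 * a 0 - a 0 * 2 : S) = 0 := by ring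
  have h2 : (a 0 ^ 2 - a 0 * a 0 * 2 + a 1 * 2 ^ 2 : S) = 4 * a 1 - a 0 ^ 2 := by ring
  rw [h1, h2, map_zero, zero_mul, sub_zero]

/-- **The first generalized discriminant** [Villamayor 2007, Introduction p0004 L93–L102 «These universal polynomials …
are to be thought of as generalized discriminants … if `D(a_1, a_2, …, a_b)` denotes the discriminant of `f(Z)`, then it
is the evaluation on the `a_i`'s of a universal polynomial, say `D(Y_1, Y_2, …, Y_b)`, which is weighted homogeneous»;
§1 p0006 L22–L23 «the discriminant of `F(Z)` is an element of this invariant ring»]: in degree `b = 2` the computable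
elimination algebra is `ℋ_{Z² + a₁Z + a₂} = S[(4a₂ − a₁²)·W²] ⊂ S[W]` — generated by the discriminant `a₁² − 4a₂` in
weight `2` (over any commutative `k`-algebra `S`; by `hElimAlgebra_eq_mulCharpolyReesOfFamily` and
`mulCharpoly_hasseDeriv_one_monicOf_two`). [cite: Villamayor2007, Introduction p0004 L93–L102] -/
theorem hElimAlgebra_two (a : Fin 2 → S) :
    hElimAlgebra k a = Algebra.adjoin S {Polynomial.monomial 2 (4 * a 1 - a 0 ^ 2)} := by
  rcases subsingleton_or_nontrivial S with hS | hS
  · apply le_antisymm <;>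
    · intro q _
      rw [Subsingleton.elim q 0]
      exact zero_mem _
  rw [hElimAlgebra_eq_mulCharpolyReesOfFamily]
  have hF : {gn : S[X] × ℕ | ∃ e : ℕ, 1 ≤ e ∧ e + 1 ≤ 2 ∧
      gn = (Polynomial.hasseDeriv e (monicOf a), 2 - e)} = {(Polynomial.hasseDeriv 1 (monicOf a), 1)} := by
    ext gn
    simp only [Set.mem_setOf_eq, Set.mem_singleton_iff]
    constructor
    · rintro ⟨e, he1, he, rfl⟩
      obtain rfl : e = 1 := by omega
      rfl
    · rintro rfl
      exact ⟨1, le_rfl, le_rfl, rfl⟩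
  rw [hF]
  unfold mulCharpolyReesOfFamily
  rw [iSup_singleton]
  dsimp only
  unfold mulCharpolyRees
  rw [natDegree_monicOf, mulCharpoly_hasseDeriv_one_monicOf_two]
  have hc1 : (Polynomial.X ^ 2 + Polynomial.C (4 * a 1 - a 0 ^ 2) : S[X]).coeff 1 = 0 := by
    rw [Polynomial.coeff_add, Polynomial.coeff_X_pow, Polynomial.coeff_C, if_neg (by norm_num),
      if_neg (by norm_num), add_zero]
  have hc0 : (Polynomial.X ^ 2 + Polynomial.C (4 * a 1 - a 0 ^ 2) : S[X]).coeff 0 = 4 * a 1 - a 0 ^ 2 := by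
    rw [Polynomial.coeff_add, Polynomial.coeff_X_pow, Polynomial.coeff_C_zero, if_neg (by norm_num), zero_add]
  apply le_antisymm
  · refine Algebra.adjoin_le ?_
    rintro _ ⟨j, hj1, hj, rfl⟩
    interval_cases j
    · rw [show 2 - 1 = 1 from rfl, hc1, map_zero]
      exact zero_mem _
    · rw [Nat.sub_self, hc0]
      exact Algebra.subset_adjoin rfl
  · refine Algebra.adjoin_mono ?_
    rintro _ rfl
    refine ⟨2, by norm_num, le_rfl, ?_⟩
    rw [Nat.sub_self, hc0]

end Quadratic

end Literature.AlgebraicGeometry.Villamayor2007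

end
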